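import Summits.FinalStateConjecture.FinalStateConjecture.Theorems.NearExtremalKappaCapture.Negative.ExponentMonotonicity

/-!
# `NearExtremalKappaCapture` (crux stmt-FinalStateConjecture-10606, route PhaseMixingCapture):
# the conjunct `Kerr.IsSubextremal M' a'` of the conclusion is logically redundant
# (negative-side support, crux-triage round 1, triager 1)

Companion to `ExponentMonotonicity.lean` (p73006). Because the crux quantifies `∃ γ p` and the
admissible exponent vectors form an up-set (`captureWith_mono`), the modulus conjunct
`|M' − M| + |a' − a| ≤ C (1 − a²/M²)^{-p} √dist`, read inside the smaller basin
`dist < c' (1 − a²/M²)^{γ'}` with `γ' = max γ (2p + 2)` and `c' = min c (M / (4(|C|+1)))²`, already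
forces the drift `|M' − M| + |a' − a| ≤ M (1 − a²/M²)/4 < M − |a|`, hence `|a'| < M'`
(`captureWith_of_withoutSub`). Consequently `near_iff_withoutSub`: the crux is equivalent to the same
statement with the sub-extremality conjunct deleted. Reading for provers and for the "second-law"
idea cards (area-excess-ratchet, area-buys-margin, second-law-pins-the-gap): sub-extremality of the
end state — and with it `κ_f ≍ κ` — costs nothing beyond the modulus; what conservation laws can add
is a modulus that bypasses the bootstrap, not the sub-extremal clause. `§4` of the companion file
(`captureWith_false_of_extremalFormation`) is unaffected: it concerns FIXED `(γ, p)`.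
Everything here is `sorry`-free real arithmetic over the companion's `CaptureWith`. [folklore]
-/

noncomputable section

namespace Summit.FinalStateConjecture.FinalStateConjecture.Theorems.NearExtremalKappaCapture.Negative

open Literature.Geometry.Lorentzian
open scoped Manifold ContDiff Topology ENNReal
open Set Filter

/-- The body of the crux at a fixed exponent vector WITHOUT the conjunct `Kerr.IsSubextremal M' a'`
in the conclusion (everything else verbatim `CaptureWith`). -/
def CaptureWithoutSub [Kerr.Facts] [Kerr.SliceFacts] (s : ℕ) (δ : ℝ) (k : ℕ) (γ p a₁ : ℝ) :
    Prop :=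
  ∀ (M : ℝ) (hM : 0 < M), ∃ c > (0 : ℝ), ∃ C : ℝ, ∀ a : ℝ, a₁ * M ≤ |a| →
    Kerr.IsSubextremal M a →
      ∀ (D : InitialDataSet 𝓘(ℝ, E3) (Kerr.slice a M)) [D.metric.HasLeviCivita],
        D.IsVacuumConstraintSolution →
          InitialDataSet.dataWeightedSobolevEDist s δ D (Kerr.data M a M hM.le) <
              ENNReal.ofReal (c * (1 - (a / M) ^ 2) ^ γ) →
            ∀ 𝒟 : VacuumCauchyDevelopment D, 𝒟.IsMaximal →
              ∃ (M' a' : ℝ) (𝒟oc : Set 𝒟.carrier), FarComplete 𝒟 ∧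
                𝒟.toSpacetime.ConvergesToKerr 𝒟oc M' a' k ∧
                  |M' - M| + |a' - a| ≤ C * (1 - (a / M) ^ 2) ^ (-p) *
                    √(InitialDataSet.dataWeightedSobolevEDist s δ D (Kerr.data M a M hM.le)).toReal

/-- Dropping the conjunct is trivial. -/
theorem captureWithoutSub_of_captureWith [Kerr.Facts] [Kerr.SliceFacts] {s : ℕ} {δ : ℝ} {k : ℕ}
    {γ p a₁ : ℝ} (h : CaptureWith s δ k γ p a₁) : CaptureWithoutSub s δ k γ p a₁ := by
  intro M hM
  obtain ⟨c, hc, C, h⟩ := h M hM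
  refine ⟨c, hc, C, fun a ha hsub D _ hvac hdist 𝒟 hmax ↦ ?_⟩
  obtain ⟨M', a', 𝒟oc, -, hfar, hconv, hmod⟩ := h a ha hsub D hvac hdist 𝒟 hmax
  exact ⟨M', a', 𝒟oc, hfar, hconv, hmod⟩

/-- Real-arithmetic core: a drift bound `≤ M χ / 4` from `(M, a)`, `|a| < M`, lands on a
sub-extremal pair. -/
theorem isSubextremal_of_drift {M a M' a' : ℝ} (hM : 0 < M) (hsub : Kerr.IsSubextremal M a)
    (hdrift : |M' - M| + |a' - a| ≤ M * (1 - (a / M) ^ 2) / 4) : Kerr.IsSubextremal M' a' := by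
  have ha : |a| < M := hsub
  have hM0 : M ≠ 0 := hM.ne'
  have key : M * (1 - (a / M) ^ 2) = 2 * (M - |a|) - (M - |a|) ^ 2 / M := by
    rw [div_pow, ← sq_abs a]
    field_simp
    ring
  have hsq : 0 ≤ (M - |a|) ^ 2 / M := div_nonneg (sq_nonneg _) hM.le
  have hx : M * (1 - (a / M) ^ 2) ≤ 2 * (M - |a|) := by rw [key]; linarith
  have h1 : |a'| ≤ |a| + |a' - a| := by
    calc |a'| = |a + (a' - a)| := by ring_nf
      _ ≤ |a| + |a' - a| := abs_add_le _ _
  have h2 : M - M' ≤ |M' - M| := by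
    rw [abs_sub_comm]; exact le_abs_self _
  show |a'| < M'
  nlinarith [abs_nonneg (M' - M), abs_nonneg (a' - a)]

/-- **Redundancy of the sub-extremality conjunct.** Capture WITHOUT `IsSubextremal M' a'` at
exponents `(γ, p)` gives full capture at every `γ' ≥ max γ (2p + 2)` (same `s, δ, k, p, a₁`;
basin constant shrunk to `min c (M/(4(|C|+1)))²`). -/
theorem captureWith_of_withoutSub [Kerr.Facts] [Kerr.SliceFacts] {s : ℕ} {δ : ℝ} {k : ℕ}
    {γ p a₁ : ℝ} (h : CaptureWithoutSub s δ k γ p a₁) {γ' : ℝ} (hγ : γ ≤ γ')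
    (hγp : 2 * p + 2 ≤ γ') : CaptureWith s δ k γ' p a₁ := by
  intro M hM
  obtain ⟨c, hc, C, h⟩ := h M hM
  have hK : 0 < M / (4 * (|C| + 1)) := by positivity
  refine ⟨min c ((M / (4 * (|C| + 1))) ^ 2), lt_min hc (by positivity), C,
    fun a ha hsub D _ hvac hdist 𝒟 hmax ↦ ?_⟩
  obtain ⟨hx0, hx1⟩ := kappaSq_pos_le_one hsub
  set x : ℝ := 1 - (a / M) ^ 2 with hxdef
  set c' : ℝ := min c ((M / (4 * (|C| + 1))) ^ 2) with hc'def
  have hc'pos : 0 < c' := lt_min hc (by positivity)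
  -- the smaller basin lies in the original one
  have hdist' : InitialDataSet.dataWeightedSobolevEDist s δ D (Kerr.data M a M hM.le) <
      ENNReal.ofReal (c * x ^ γ) := by
    refine hdist.trans_le (ENNReal.ofReal_le_ofReal ?_)
    exact mul_le_mul (min_le_left _ _) (Real.rpow_le_rpow_of_exponent_ge hx0 hx1 hγ)
      (Real.rpow_nonneg hx0.le _) hc.le
  obtain ⟨M', a', 𝒟oc, hfar, hconv, hmod⟩ := h a ha hsub D hvac hdist' 𝒟 hmax
  refine ⟨M', a', 𝒟oc, ?_, hfar, hconv, hmod⟩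
  -- drift bound
  set d : ℝ := (InitialDataSet.dataWeightedSobolevEDist s δ D (Kerr.data M a M hM.le)).toReal
    with hddef
  have hd0 : 0 ≤ d := ENNReal.toReal_nonneg
  have hdlt : d < c' * x ^ γ' := ENNReal.toReal_lt_of_lt_ofReal hdist
  have hxg : 0 ≤ x ^ (γ' / 2) := Real.rpow_nonneg hx0.le _
  have hsq : (√c' * x ^ (γ' / 2)) ^ 2 = c' * x ^ γ' := by
    rw [mul_pow, Real.sq_sqrt hc'pos.le, ← Real.rpow_natCast (x ^ (γ' / 2)) 2,
      ← Real.rpow_mul hx0.le]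
    norm_num
  have hsqrt_d : √d ≤ √c' * x ^ (γ' / 2) := by
    rw [← Real.sqrt_sq (mul_nonneg (Real.sqrt_nonneg _) hxg), hsq]
    exact Real.sqrt_le_sqrt hdlt.le
  have hsqrtc : √c' ≤ M / (4 * (|C| + 1)) := by
    calc √c' ≤ √((M / (4 * (|C| + 1))) ^ 2) := Real.sqrt_le_sqrt (min_le_right _ _)
      _ = M / (4 * (|C| + 1)) := Real.sqrt_sq hK.le
  have hxpow : x ^ (-p) * x ^ (γ' / 2) ≤ x := by
    rw [← Real.rpow_add hx0]
    calc x ^ (-p + γ' / 2) ≤ x ^ (1 : ℝ) :=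
          Real.rpow_le_rpow_of_exponent_ge hx0 hx1 (by linarith)
      _ = x := Real.rpow_one x
  have hxp0 : 0 ≤ x ^ (-p) := Real.rpow_nonneg hx0.le _
  have hdrift : |M' - M| + |a' - a| ≤ M * x / 4 := by
    calc |M' - M| + |a' - a| ≤ C * x ^ (-p) * √d := hmod
      _ ≤ |C| * x ^ (-p) * √d :=
          mul_le_mul_of_nonneg_right (mul_le_mul_of_nonneg_right (le_abs_self C) hxp0)
            (Real.sqrt_nonneg _)
      _ ≤ |C| * x ^ (-p) * (√c' * x ^ (γ' / 2)) :=
          mul_le_mul_of_nonneg_left hsqrt_d (mul_nonneg (abs_nonneg C) hxp0)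
      _ = |C| * √c' * (x ^ (-p) * x ^ (γ' / 2)) := by ring
      _ ≤ |C| * (M / (4 * (|C| + 1))) * x := by
          apply mul_le_mul (mul_le_mul_of_nonneg_left hsqrtc (abs_nonneg C)) hxpow
            (mul_nonneg hxp0 hxg) (mul_nonneg (abs_nonneg C) hK.le)
      _ ≤ M * x / 4 := by
          have hC1 : |C| / (|C| + 1) ≤ 1 := (div_le_one (by positivity)).mpr (by linarith)
          have : |C| * (M / (4 * (|C| + 1))) = (|C| / (|C| + 1)) * (M / 4) := by
            field_simp
          rw [this]
          have hMx : 0 ≤ M / 4 * x := by positivity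
          calc |C| / (|C| + 1) * (M / 4) * x = (|C| / (|C| + 1)) * (M / 4 * x) := by ring
            _ ≤ 1 * (M / 4 * x) := mul_le_mul_of_nonneg_right hC1 hMx
            _ = M * x / 4 := by ring
  exact isSubextremal_of_drift hM hsub (by simpa [hxdef, mul_div_assoc] using hdrift)

/-- **Corollary (what the three second-law cards discharge is already discharged).**
`NearExtremalKappaCapture` is equivalent to the same statement with the conjunct
`Kerr.IsSubextremal M' a'` deleted from the conclusion. -/
theorem near_iff_withoutSub :
    Theses.PhaseMixingCapture.NearExtremalKappaCapture ↔
      ∀ [Kerr.Facts] [Kerr.SliceFacts], ∃ (s : ℕ) (δ : ℝ) (k : ℕ) (γ p a₁ : ℝ),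
        a₁ < 1 ∧ CaptureWithoutSub s δ k γ p a₁ := by
  rw [near_iff]
  constructor
  · intro h hF hS
    obtain ⟨s, δ, k, γ, p, a₁, ha₁, h⟩ := @h hF hS
    exact ⟨s, δ, k, γ, p, a₁, ha₁, captureWithoutSub_of_captureWith h⟩
  · intro h hF hS
    obtain ⟨s, δ, k, γ, p, a₁, ha₁, h⟩ := @h hF hS
    exact ⟨s, δ, k, max γ (2 * p + 2), p, a₁, ha₁,
      captureWith_of_withoutSub h (le_max_left _ _) (le_max_right _ _)⟩

end Summit.FinalStateConjecture.FinalStateConjecture.Theorems.NearExtremalKappaCapture.Negative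

end
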